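import Summits.FinalStateConjecture.FinalStateConjecture.Theses.DissipativeFinalMotions
import Summits.FinalStateConjecture.FinalStateConjecture.Theorems.ZeroEnergyKerrOrBombStationaryLimitReductionOneDevelopment
import Summits.FinalStateConjecture.FinalStateConjecture.Theorems.PhaseMixingCaptureWeakCosmicCensorshipMGHDCompleteNullInfinityInvariant
import Summits.FinalStateConjecture.FinalStateConjecture.Theorems.EIHFluxBalanceModulatedKerrHandoffStubRaysStayInClosureTransport
import Summits.FinalStateConjecture.FinalStateConjecture.Theorems.EIHFluxBalanceModulatedKerrHandoffStubRayTransport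
import Literature.Geometry.Lorentzian.MGHDUniqueness
import HarnessLib

/-!
# Route DissipativeFinalMotions — crux `FinalEraGeneric` (stmt-FinalStateConjecture-17642), line `registered`:
# the crux's per-datum property is an invariant of isometric developments, so its `∃ ∧ ∀` bundling
# collapses — `FinalEraGeneric` in `∃`-form

The crux `FinalEraGeneric` asserts tame-generically the per-datum property
`P D := (∃ MGHD) ∧ ∀ MGHD 𝒟, 𝓘⁺ complete ∧ ∃ (31-clause rev-2 era `IsFinalEra₂ …`) ∧ (R) ∧ (F) ∧ (F₀)`.
This file proves, with no named fact:

* `isFinalEra₂_transport` — the 31-clause rev-2 final-era package `CauchyDevelopment.IsFinalEra₂` is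
  TRANSPORTED along a time-orientation preserving isometric diffeomorphism of developments `ψ : 𝒟₁ ≃ 𝒟₂`
  (`ψ ∘ ι₁ = ι₂`): same binders, charts composed with `ψ`, region `ψ(O)`. Every clause rides along: the
  self-determined exterior (`image_exteriorOf`), late charts (`isLateChart_comp`), the metric deviations are
  literally unchanged (`Spacetime.deviation_comp`), chart-image clauses by injectivity of `ψ`, exhaustion by
  `ψ(J⁻(S)) = J⁻(ψ(S))` (`image_causalPast_eq`);
* `honestOrientedEra_transport` — so is the crux's full post-maximality property (complete `𝓘⁺` by
  `hasCompleteNullInfinity_iff_of_isIsometricTo`; (R) by the ray correspondence `stub_rayTransport` /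
  `stub_raysStayInClosure_transport`; (F), (F₀) by the chain rule and O'Neill's timecone lemma
  `PreservesTimeOrientation.isFutureDirected_mfderiv`);
* `finalEraProperty_iff_exists` — hence, by the PROVED uniqueness of the MGHD up to isometry of
  developments (`mghd_unique_cauchy`), `P D ↔ ∃ 𝒟 MGHD, 𝓘⁺ complete ∧ honest oriented era in 𝒟`:
  the `∃`-form a stability theorem produces (one maximal development serves all);
* `finalEraGeneric_iff_existsForm` — the crux BY NAME is equivalent to tame genericity of that `∃`-form.

Helper lemmas for the crux (`--supports`); they do not close it. References: Choquet-Bruhat–Geroch, CMP 14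
(1969), Thm. 3; Ringström 2009, Thm. 16.6; O'Neill 1983, Ch. 3 pp. 58, 90–91, Ch. 5 p. 145, Ch. 14 pp. 402–403;
Dafermos–Luk arXiv:1710.01722, p. 8 and Conjecture 1 (the final-state picture the package renders).
-/

noncomputable section

-- `<Problem> = <Summit>` doubles the namespace component (tree-wide convention)
set_option linter.dupNamespace false

open Set Filter Topology Function
open scoped Manifold ContDiff Topology
open Literature.Geometry.Lorentzian

namespace Summit.FinalStateConjecture.FinalStateConjecture.Theorems.DissipativeFinalMotions.FinalEraGeneric

open Summit.FinalStateConjecture.FinalStateConjecture.Theses.DissipativeFinalMotions (FinalEraGeneric)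
open Summit.FinalStateConjecture.FinalStateConjecture.Theorems.OneLockedExplosion
  (mdifferentiable_diffeomorph image_causalPast_eq isLateChart_comp truncDeviationCk_comp image_exteriorOf)
open Summit.FinalStateConjecture.FinalStateConjecture.Theorems.PhaseMixingCapture.WeakCosmicCensorshipMGHD
  (hasCompleteNullInfinity_iff_of_isIsometricTo)
open Summit.FinalStateConjecture.FinalStateConjecture.Theorems.EIHFluxBalance.TameTemplate
  (stub_raysStayInClosure_transport stub_rayTransport)

section Transport

variable {X : Type} [TopologicalSpace X] [ChartedSpace E3 X] [IsManifold (𝓡 3) ∞ X] [T2Space X]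
  [SecondCountableTopology X] [ConnectedSpace X] {D : InitialDataSet (𝓡 3) X}

omit [T2Space X] [SecondCountableTopology X] in
/-- **The rev-2 final-era package is transported along an isometry of developments.** For Cauchy
developments `𝒟₁`, `𝒟₂` of `D`, a time-orientation preserving isometric diffeomorphism `ψ : M₁ ≃ M₂` with
`ψ ∘ ι₁ = ι₂`, and a tuple `(N, M, a, T, δ, V, C₁, C₂, ρ₀, κ, ξ, β, U₀, B₀, B, Ψ₀, Ψ, O)` satisfying the 31 clauses
of `IsFinalEra₂` in `𝒟₁`, the tuple with the charts composed with `ψ` and the region `ψ(O)` satisfies them in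
`𝒟₂`: `ψ(J⁺(ι₁X) ∩ I⁻(U)) = J⁺(ι₂X) ∩ I⁻(ψ U)` (`image_exteriorOf`), late charts compose (`isLateChart_comp`),
`(ψ ∘ Ψ)^* g₂ − g_B = Ψ^* g₁ − g_B` (`Spacetime.deviation_comp`), the chart-image clauses by injectivity of
`ψ`, and `ψ(J⁻(S)) = J⁻(ψ S)` (`image_causalPast_eq`). O'Neill 1983, Ch. 3, p. 58; Ch. 14, pp. 402–403.
[cite: ONeill1983, Ch. 3, p. 58] -/
theorem isFinalEra₂_transport (𝒟₁ 𝒟₂ : CauchyDevelopment D)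
    (ψ : Diffeomorph (𝓡 4) (𝓡 4) 𝒟₁.carrier 𝒟₂.carrier ∞)
    (hiso : 𝒟₁.metric.IsIsometry 𝒟₂.metric.toPseudoRiemannianMetric ψ)
    (hτ : 𝒟₁.timeOrientation.PreservesTimeOrientation ψ 𝒟₂.timeOrientation)
    (hι : ψ ∘ 𝒟₁.embed = 𝒟₂.embed)
    {N : ℕ} {M a : Fin N → ℝ} {T δ V C₁ C₂ ρ₀ κ : ℝ} {ξ : Fin N → ℝ → E3} {β : ℝ → ℝ}
    {U₀ : TopologicalSpace.Opens E4} {B₀ : ModelBackground} {B : Fin N → ModelBackground}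
    {Ψ₀ : B₀.domain → 𝒟₁.carrier} {Ψ : (i : Fin N) → (B i).domain → 𝒟₁.carrier} {O : Set 𝒟₁.carrier}
    (h : 𝒟₁.IsFinalEra₂ N M a T δ V C₁ C₂ ρ₀ κ ξ β U₀ B₀ B Ψ₀ Ψ O) :
    𝒟₂.IsFinalEra₂ N M a T δ V C₁ C₂ ρ₀ κ ξ β U₀ B₀ B (ψ ∘ Ψ₀) (fun i ↦ ψ ∘ Ψ i) (ψ '' O) := by
  obtain ⟨hO, hB₀, hB, hsub, hδ, hV0, hV1, hC₁, hC₂, hρ₀, hκ, hξ, hfloor, hlip, hβi, hβ0, hlaw, hF1, hF2,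
    hF3, hH1, hH2, hH3, hX1, hX2, hX3, hX4a, hX4b, hEX, hAT, hND⟩ := h
  have hinj : Function.Injective ψ := ψ.injective
  -- the metric deviations of the charts are unchanged by composing with the isometry `ψ`
  have hdev₀ : 𝒟₂.toSpacetime.deviationExtend B₀ (ψ ∘ Ψ₀) = 𝒟₁.toSpacetime.deviationExtend B₀ Ψ₀ := by
    unfold Spacetime.deviationExtend
    rw [Spacetime.deviation_comp B₀ (mdifferentiable_diffeomorph ψ) hiso
      (hF1.contMDiff.mdifferentiable (by simp))]
  have hdev : ∀ i, 𝒟₂.toSpacetime.deviationExtend (B i) (ψ ∘ Ψ i) =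
      𝒟₁.toSpacetime.deviationExtend (B i) (Ψ i) := fun i ↦ by
    unfold Spacetime.deviationExtend
    rw [Spacetime.deviation_comp (B i) (mdifferentiable_diffeomorph ψ) hiso
      ((hH1 i).contMDiff.mdifferentiable (by simp))]
  refine ⟨?_, hB₀, hB, hsub, hδ, hV0, hV1, hC₁, hC₂, hρ₀, hκ, hξ, hfloor, hlip, hβi, hβ0, hlaw,
    isLateChart_comp ψ B₀ hF1, hF2, ?_, fun i ↦ isLateChart_comp ψ (B i) (hH1 i), ?_, ?_, ?_, ?_, ?_, ?_,
    ?_, ?_, ?_, hND⟩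
  · -- (O) the self-determined exterior is transported
    have h1 : ψ '' O = Summit.FinalStateConjecture.exteriorOf 𝒟₂
        (ψ '' (Ψ₀ '' B₀.lateRegion T ∪ ⋃ i, Ψ i '' (B i).lateRegion T)) := by
      rw [hO]
      exact image_exteriorOf ψ hiso hτ hι _
    rw [h1, Set.image_union, Set.image_iUnion]
    simp only [← Set.image_comp]
    rfl
  · -- (F3) far flatness of the flat chart
    intro ε hε
    obtain ⟨ϱ, T', h'⟩ := hF3 ε hε
    exact ⟨ϱ, T', fun τ hτ' ↦ by rw [hdev₀]; exact h' τ hτ'⟩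
  · -- (H2′) the scale-covariant near-zone pin
    intro i m x hm hT hr
    rw [hdev i]
    exact hH2 i m x hm hT hr
  · -- (H3) effacement
    intro i R ε hε
    obtain ⟨D', hD'⟩ := hH3 i R ε hε
    refine ⟨D', fun T' hT' ↦ ?_⟩
    obtain ⟨T'', h''⟩ := hD' T' hT'
    refine ⟨T'', fun τ hτ' ↦ ?_⟩
    have hc := truncDeviationCk_comp ψ (B i) (hH1 i).contMDiff hiso 2 R τ
    simp only at hc ⊢
    rw [hc]
    exact h'' τ hτ'
  · -- (X1) hole charts overlap only inside the flat chart's range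
    intro i j hij
    simp only [Set.image_comp, Set.range_comp]
    rw [← Set.image_inter hinj]
    exact Set.image_mono (hX1 i j hij)
  · -- (X2) two-sided chart localisation, first half
    intro i x y hT hxy
    exact hX2 i x y hT (hinj hxy)
  · -- (X3) two-sided chart localisation, second half
    intro i R
    obtain ⟨T₃, h₃⟩ := hX3 i R
    refine ⟨T₃, fun y hy hR ↦ ?_⟩
    obtain ⟨x, hx, hTx, hrx⟩ := h₃ y hy hR
    exact ⟨x, congrArg ψ hx, hTx, hrx⟩
  · -- (X4) clock comparison, first half
    intro i t₀
    obtain ⟨τ', h'⟩ := hX4a i t₀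
    refine ⟨τ', ?_⟩
    rw [Set.image_comp, Set.image_comp, ← Set.image_inter hinj, h', Set.image_empty]
  · -- (X4) clock comparison, second half
    intro i τ' R
    obtain ⟨t₀, h'⟩ := hX4b i τ' R
    refine ⟨t₀, ?_⟩
    rw [Set.image_comp, Set.image_comp, ← Set.image_inter hinj, h', Set.image_empty]
  · -- (EX) exhaustion: `ψ(J⁻(S)) = J⁻(ψ S)`
    intro τ₁ hτ₁
    have h' := hEX τ₁ hτ₁
    simp only [Set.image_comp, ← Set.image_iUnion, ← Set.image_union]
    rw [← Set.image_sdiff hinj, ← image_causalPast_eq (𝓢₁ := 𝒟₁.toSpacetime) (𝓢₂ := 𝒟₂.toSpacetime)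
      ψ hiso hτ]
    exact Set.image_mono h'
  · -- (AT) the certified tubes stay pairwise disjoint
    intro i j hij
    have hd := hAT hij
    dsimp only [Function.onFun] at hd ⊢
    rw [Set.image_comp, Set.image_comp]
    exact Set.disjoint_image_of_injective hinj hd

omit [T2Space X] [SecondCountableTopology X] in
/-- **Future orientation of a chart rides along a time-orientation preserving isometry**: by the chain
rule `d(ψ ∘ Ψ) v = dψ (dΨ v)`, and `dψ` maps future-directed causal vectors to future-directed causal
vectors (O'Neill's timecone lemma). [cite: ONeillSemiRiemannian1983, Ch. 5, p. 145] -/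
theorem isFutureDirected_mfderiv_comp (𝒟₁ 𝒟₂ : CauchyDevelopment D)
    (ψ : Diffeomorph (𝓡 4) (𝓡 4) 𝒟₁.carrier 𝒟₂.carrier ∞)
    (hiso : 𝒟₁.metric.IsIsometry 𝒟₂.metric.toPseudoRiemannianMetric ψ)
    (hτ : 𝒟₁.timeOrientation.PreservesTimeOrientation ψ 𝒟₂.timeOrientation)
    {U : TopologicalSpace.Opens E4} {Φ : U → 𝒟₁.carrier} (hΦ : ContMDiff 𝓘(ℝ, E4) (𝓡 4) ∞ Φ)
    {x : U} {v : E4}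
    (hv : 𝒟₁.toSpacetime.timeOrientation.IsFutureDirected (mfderiv 𝓘(ℝ, E4) (𝓡 4) Φ x v)) :
    𝒟₂.toSpacetime.timeOrientation.IsFutureDirected (mfderiv 𝓘(ℝ, E4) (𝓡 4) (ψ ∘ Φ) x v) := by
  have hc : MDifferentiableAt 𝓘(ℝ, E4) (𝓡 4) Φ x := (hΦ.mdifferentiable (by simp)) x
  rw [mfderiv_comp x (mdifferentiable_diffeomorph ψ _) hc]
  exact hτ.isFutureDirected_mfderiv hiso hv

/-- **The crux's full post-maximality property is transported along an isometry of vacuum Cauchy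
developments.** If `𝒟₁ ≅ 𝒟₂` as developments and `𝒟₁` has complete `𝓘⁺` and an honest oriented rev-2 era
— `IsFinalEra₂ …` ∧ (R) `RaysStayInClosure` ∧ (F) eventual future orientation of every hole chart on every
truncated slab ∧ (F₀) eventual future orientation of the flat chart far from the holes — then so does `𝒟₂`
(complete `𝓘⁺`: `hasCompleteNullInfinity_iff_of_isIsometricTo`; the package: `isFinalEra₂_transport`; (R): the
ray correspondence `stub_rayTransport` and `stub_raysStayInClosure_transport`; (F), (F₀): chain rule and timecone
lemma). [cite: Ringstrom2009, Thm. 16.6] -/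
theorem honestOrientedEra_transport (𝒟₁ 𝒟₂ : VacuumCauchyDevelopment D)
    (hI : 𝒟₁.toCauchyDevelopment.IsIsometricTo 𝒟₂.toCauchyDevelopment)
    (h₁ : Summit.FinalStateConjecture.HasCompleteNullInfinity 𝒟₁.toCauchyDevelopment ∧
      ∃ (N : ℕ) (M a : Fin N → ℝ) (T δ V C₁ C₂ ρ₀ κ : ℝ) (ξ : Fin N → ℝ → EuclideanSpace ℝ (Fin 3))
        (β : ℝ → ℝ) (U₀ : TopologicalSpace.Opens E4) (B₀ : ModelBackground) (B : Fin N → ModelBackground)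
        (Ψ₀ : B₀.domain → 𝒟₁.carrier) (Ψ : (i : Fin N) → (B i).domain → 𝒟₁.carrier) (O : Set 𝒟₁.carrier),
        𝒟₁.toCauchyDevelopment.IsFinalEra₂ N M a T δ V C₁ C₂ ρ₀ κ ξ β U₀ B₀ B Ψ₀ Ψ O ∧
          Summit.FinalStateConjecture.RaysStayInClosure 𝒟₁.toCauchyDevelopment O ∧
            (∀ i (ρ : ℝ), ∀ᶠ τ in atTop, ∀ x ∈ (B i).truncTimeSlab ρ τ,
              𝒟₁.toSpacetime.timeOrientation.IsFutureDirected
                (mfderiv 𝓘(ℝ, E4) (𝓡 4) (Ψ i) x (Kerr.timeVector (M i) (a i) x.1))) ∧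
              ∃ ϱ₀ : ℝ, ∀ᶠ τ in atTop, ∀ x ∈ B₀.timeSlab τ, (∀ i, ϱ₀ ≤ ‖E4.spatial x.1 - ξ i τ‖) →
                𝒟₁.toSpacetime.timeOrientation.IsFutureDirected
                  (mfderiv 𝓘(ℝ, E4) (𝓡 4) Ψ₀ x (E4.basisVector 0))) :
    Summit.FinalStateConjecture.HasCompleteNullInfinity 𝒟₂.toCauchyDevelopment ∧
      ∃ (N : ℕ) (M a : Fin N → ℝ) (T δ V C₁ C₂ ρ₀ κ : ℝ) (ξ : Fin N → ℝ → EuclideanSpace ℝ (Fin 3))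
        (β : ℝ → ℝ) (U₀ : TopologicalSpace.Opens E4) (B₀ : ModelBackground) (B : Fin N → ModelBackground)
        (Ψ₀ : B₀.domain → 𝒟₂.carrier) (Ψ : (i : Fin N) → (B i).domain → 𝒟₂.carrier) (O : Set 𝒟₂.carrier),
        𝒟₂.toCauchyDevelopment.IsFinalEra₂ N M a T δ V C₁ C₂ ρ₀ κ ξ β U₀ B₀ B Ψ₀ Ψ O ∧
          Summit.FinalStateConjecture.RaysStayInClosure 𝒟₂.toCauchyDevelopment O ∧
            (∀ i (ρ : ℝ), ∀ᶠ τ in atTop, ∀ x ∈ (B i).truncTimeSlab ρ τ,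
              𝒟₂.toSpacetime.timeOrientation.IsFutureDirected
                (mfderiv 𝓘(ℝ, E4) (𝓡 4) (Ψ i) x (Kerr.timeVector (M i) (a i) x.1))) ∧
              ∃ ϱ₀ : ℝ, ∀ᶠ τ in atTop, ∀ x ∈ B₀.timeSlab τ, (∀ i, ϱ₀ ≤ ‖E4.spatial x.1 - ξ i τ‖) →
                𝒟₂.toSpacetime.timeOrientation.IsFutureDirected
                  (mfderiv 𝓘(ℝ, E4) (𝓡 4) Ψ₀ x (E4.basisVector 0)) := by
  obtain ⟨hcni, N, M, a, T, δ, V, C₁, C₂, ρ₀, κ, ξ, β, U₀, B₀, B, Ψ₀, Ψ, O, hera, hR, hF, ϱ₀, hF₀⟩ := h₁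
  refine ⟨(hasCompleteNullInfinity_iff_of_isIsometricTo _ _ hI).1 hcni, ?_⟩
  obtain ⟨ψ, hiso, hτ, hι⟩ := hI
  have hera₂ := isFinalEra₂_transport 𝒟₁.toCauchyDevelopment 𝒟₂.toCauchyDevelopment ψ hiso hτ hι hera
  refine ⟨N, M, a, T, δ, V, C₁, C₂, ρ₀, κ, ξ, β, U₀, B₀, B, ψ ∘ Ψ₀, fun i ↦ ψ ∘ Ψ i, ψ '' O, hera₂, ?_,
    fun i ρ ↦ (hF i ρ).mono fun τ hτ' x hx ↦ ?_, ϱ₀, hF₀.mono fun τ hτ' x hx hfar ↦ ?_⟩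
  · -- (R) rays stay in `closure (ψ O)`: ray correspondence along `ψ`
    exact stub_raysStayInClosure_transport X D 𝒟₁ 𝒟₂ ψ hiso hτ hι
      (fun p γ dom ↦ stub_rayTransport X D 𝒟₁ 𝒟₂ ψ hiso hτ hι p γ dom) O hR
  · -- (F) hole charts: chain rule + timecone lemma
    exact isFutureDirected_mfderiv_comp 𝒟₁.toCauchyDevelopment 𝒟₂.toCauchyDevelopment ψ hiso hτ
      (hera.2.2.2.2.2.2.2.2.2.2.2.2.2.2.2.2.2.2.2.2.1 i).contMDiff (hτ' x hx)
  · -- (F₀) flat chart far from the holes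
    exact isFutureDirected_mfderiv_comp 𝒟₁.toCauchyDevelopment 𝒟₂.toCauchyDevelopment ψ hiso hτ
      hera.2.2.2.2.2.2.2.2.2.2.2.2.2.2.2.2.2.1.contMDiff (hτ' x hx hfar)

/-- **The crux's `∃ ∧ ∀` bundling collapses, unconditionally.** For any datum `D`, "an MGHD exists AND
every MGHD has complete `𝓘⁺` and an honest oriented rev-2 era with (R), (F), (F₀)" — the per-datum property
whose tame genericity `FinalEraGeneric` asserts — is equivalent to "SOME MGHD has complete `𝓘⁺` and an honest
oriented rev-2 era with (R), (F), (F₀)": all MGHDs of `D` are isometric as developments (`mghd_unique_cauchy`,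
proved in the tree) and the property is transported along isometries (`honestOrientedEra_transport`). This is
the `∃`-form a stability/final-state theorem produces: ONE maximal development serves all.
[cite: ChoquetBruhatGeroch1969CMP, Thm. 3 (pp. 332–334)] -/
theorem finalEraProperty_iff_exists (D : InitialDataSet (𝓡 3) X) :
    ((∃ 𝒟 : VacuumCauchyDevelopment D, 𝒟.IsMaximal) ∧
      ∀ 𝒟 : VacuumCauchyDevelopment D, 𝒟.IsMaximal →
        Summit.FinalStateConjecture.HasCompleteNullInfinity 𝒟.toCauchyDevelopment ∧
          ∃ (N : ℕ) (M a : Fin N → ℝ) (T δ V C₁ C₂ ρ₀ κ : ℝ) (ξ : Fin N → ℝ → EuclideanSpace ℝ (Fin 3))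
            (β : ℝ → ℝ) (U₀ : TopologicalSpace.Opens E4) (B₀ : ModelBackground)
            (B : Fin N → ModelBackground) (Ψ₀ : B₀.domain → 𝒟.carrier)
            (Ψ : (i : Fin N) → (B i).domain → 𝒟.carrier) (O : Set 𝒟.carrier),
            𝒟.toCauchyDevelopment.IsFinalEra₂ N M a T δ V C₁ C₂ ρ₀ κ ξ β U₀ B₀ B Ψ₀ Ψ O ∧
              Summit.FinalStateConjecture.RaysStayInClosure 𝒟.toCauchyDevelopment O ∧
                (∀ i (ρ : ℝ), ∀ᶠ τ in atTop, ∀ x ∈ (B i).truncTimeSlab ρ τ,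
                  𝒟.toSpacetime.timeOrientation.IsFutureDirected
                    (mfderiv 𝓘(ℝ, E4) (𝓡 4) (Ψ i) x (Kerr.timeVector (M i) (a i) x.1))) ∧
                  ∃ ϱ₀ : ℝ, ∀ᶠ τ in atTop, ∀ x ∈ B₀.timeSlab τ,
                    (∀ i, ϱ₀ ≤ ‖E4.spatial x.1 - ξ i τ‖) →
                      𝒟.toSpacetime.timeOrientation.IsFutureDirected
                        (mfderiv 𝓘(ℝ, E4) (𝓡 4) Ψ₀ x (E4.basisVector 0))) ↔
      ∃ 𝒟 : VacuumCauchyDevelopment D, 𝒟.IsMaximal ∧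
        (Summit.FinalStateConjecture.HasCompleteNullInfinity 𝒟.toCauchyDevelopment ∧
          ∃ (N : ℕ) (M a : Fin N → ℝ) (T δ V C₁ C₂ ρ₀ κ : ℝ) (ξ : Fin N → ℝ → EuclideanSpace ℝ (Fin 3))
            (β : ℝ → ℝ) (U₀ : TopologicalSpace.Opens E4) (B₀ : ModelBackground)
            (B : Fin N → ModelBackground) (Ψ₀ : B₀.domain → 𝒟.carrier)
            (Ψ : (i : Fin N) → (B i).domain → 𝒟.carrier) (O : Set 𝒟.carrier),
            𝒟.toCauchyDevelopment.IsFinalEra₂ N M a T δ V C₁ C₂ ρ₀ κ ξ β U₀ B₀ B Ψ₀ Ψ O ∧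
              Summit.FinalStateConjecture.RaysStayInClosure 𝒟.toCauchyDevelopment O ∧
                (∀ i (ρ : ℝ), ∀ᶠ τ in atTop, ∀ x ∈ (B i).truncTimeSlab ρ τ,
                  𝒟.toSpacetime.timeOrientation.IsFutureDirected
                    (mfderiv 𝓘(ℝ, E4) (𝓡 4) (Ψ i) x (Kerr.timeVector (M i) (a i) x.1))) ∧
                  ∃ ϱ₀ : ℝ, ∀ᶠ τ in atTop, ∀ x ∈ B₀.timeSlab τ,
                    (∀ i, ϱ₀ ≤ ‖E4.spatial x.1 - ξ i τ‖) →
                      𝒟.toSpacetime.timeOrientation.IsFutureDirected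
                        (mfderiv 𝓘(ℝ, E4) (𝓡 4) Ψ₀ x (E4.basisVector 0))) := by
  constructor
  · rintro ⟨⟨𝒟, hmax⟩, hall⟩
    exact ⟨𝒟, hmax, hall 𝒟 hmax⟩
  · rintro ⟨𝒟, hmax, hQ⟩
    exact ⟨⟨𝒟, hmax⟩, fun 𝒟' hmax' ↦
      honestOrientedEra_transport 𝒟 𝒟' (mghd_unique_cauchy 𝒟 𝒟' hmax hmax') hQ⟩

end Transport

/-- **`FinalEraGeneric` in `∃`-form.** The crux BY NAME is equivalent to: for every connected Hausdorff
second-countable `3`-manifold `X`, tame-Christodoulou-generically on `admissibleVacuumData X`, SOME maximal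
vacuum Cauchy development of the datum has complete `𝓘⁺` and an honest oriented rev-2 final era (package
`IsFinalEra₂ …`, (R), (F), (F₀)). The two per-datum properties agree pointwise (`finalEraProperty_iff_exists`),
so their exceptional sets — hence their tame genericity — coincide. A prover of the crux (or of the registered
relative stubs) may therefore deliver ONE MGHD with an era per good datum; a refuter needs ONE MGHD without.
[cite: DafermosLuk2017, Conjecture 1] -/
theorem finalEraGeneric_iff_existsForm : open scoped Manifold in (Summit.FinalStateConjecture.FinalStateConjecture.Theses.DissipativeFinalMotions.FinalEraGeneric ↔ ∀ (X : Type) [TopologicalSpace X] [ChartedSpace (EuclideanSpace ℝ (Fin 3)) X] [IsManifold (𝓡 3) ((⊤ : ℕ∞) : WithTop ℕ∞) X] [T2Space X] [SecondCountableTopology X] [ConnectedSpace X], Literature.Geometry.Lorentzian.InitialDataSet.IsTameChristodoulouGeneric (Literature.Geometry.Lorentzian.admissibleVacuumData X) (fun D ↦ ∃ 𝒟 : Literature.Geometry.Lorentzian.VacuumCauchyDevelopment D, 𝒟.IsMaximal ∧ (Summit.FinalStateConjecture.HasCompleteNullInfinity 𝒟.toCauchyDevelopment ∧ ∃ (N :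 ℕ) (M a : Fin N → ℝ) (T δ V C₁ C₂ ρ₀ κ : ℝ) (ξ : Fin N → ℝ → EuclideanSpace ℝ (Fin 3)) (β : ℝ → ℝ) (U₀ : TopologicalSpace.Opens Literature.Geometry.Lorentzian.E4) (B₀ : Literature.Geometry.Lorentzian.ModelBackground) (B : Fin N → Literature.Geometry.Lorentzian.ModelBackground) (Ψ₀ : B₀.domain → 𝒟.carrier) (Ψ : (i : Fin N) → (B i).domain → 𝒟.carrier) (O : Set 𝒟.carrier), 𝒟.toCauchyDevelopment.IsFinalEra₂ N M a T δ V C₁ C₂ ρ₀ κ ξ β U₀ B₀ B Ψ₀ Ψ O ∧ Summit.FinalStateConjecture.RaysStayInClosure 𝒟.toCauchyDevelopment O ∧ (∀ i (ρ : ℝ), ∀ᶠ τ in Filter.atTop, ∀ x ∈ (B i).truncTimeSlab ρ τ, 𝒟.toSpacetime.timeOrientation.IsFutureDirected (mfderiv 𝓘(ℝ, Literature.Geometry.Lorentzian.E4) (𝓡 4) (Ψ i) x (Literature.Geometry.Lorentzian.Kerr.timeVector (M i) (a i) x.1))) ∧ ∃ ϱ₀ : ℝ, ∀ᶠ τ in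 Filter.atTop, ∀ x ∈ B₀.timeSlab τ, (∀ i, ϱ₀ ≤ ‖Literature.Geometry.Lorentzian.E4.spatial x.1 - ξ i τ‖) → 𝒟.toSpacetime.timeOrientation.IsFutureDirected (mfderiv 𝓘(ℝ, Literature.Geometry.Lorentzian.E4) (𝓡 4) Ψ₀ x (Literature.Geometry.Lorentzian.E4.basisVector 0)))) 1) := by
  unfold FinalEraGeneric
  refine forall_congr' fun X ↦ forall_congr' fun _ ↦ forall_congr' fun _ ↦ forall_congr' fun _ ↦
    forall_congr' fun _ ↦ forall_congr' fun _ ↦ forall_congr' fun _ ↦ ?_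
  have hP : (fun D : InitialDataSet (𝓡 3) X ↦ (∃ 𝒟 : VacuumCauchyDevelopment D, 𝒟.IsMaximal) ∧
      ∀ 𝒟 : VacuumCauchyDevelopment D, 𝒟.IsMaximal →
        Summit.FinalStateConjecture.HasCompleteNullInfinity 𝒟.toCauchyDevelopment ∧
          ∃ (N : ℕ) (M a : Fin N → ℝ) (T δ V C₁ C₂ ρ₀ κ : ℝ) (ξ : Fin N → ℝ → EuclideanSpace ℝ (Fin 3))
            (β : ℝ → ℝ) (U₀ : TopologicalSpace.Opens E4) (B₀ : ModelBackground)
            (B : Fin N → ModelBackground) (Ψ₀ : B₀.domain → 𝒟.carrier)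
            (Ψ : (i : Fin N) → (B i).domain → 𝒟.carrier) (O : Set 𝒟.carrier),
            𝒟.toCauchyDevelopment.IsFinalEra₂ N M a T δ V C₁ C₂ ρ₀ κ ξ β U₀ B₀ B Ψ₀ Ψ O ∧
              Summit.FinalStateConjecture.RaysStayInClosure 𝒟.toCauchyDevelopment O ∧
                (∀ i (ρ : ℝ), ∀ᶠ τ in atTop, ∀ x ∈ (B i).truncTimeSlab ρ τ,
                  𝒟.toSpacetime.timeOrientation.IsFutureDirected
                    (mfderiv 𝓘(ℝ, E4) (𝓡 4) (Ψ i) x (Kerr.timeVector (M i) (a i) x.1))) ∧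
                  ∃ ϱ₀ : ℝ, ∀ᶠ τ in atTop, ∀ x ∈ B₀.timeSlab τ,
                    (∀ i, ϱ₀ ≤ ‖E4.spatial x.1 - ξ i τ‖) →
                      𝒟.toSpacetime.timeOrientation.IsFutureDirected
                        (mfderiv 𝓘(ℝ, E4) (𝓡 4) Ψ₀ x (E4.basisVector 0))) =
      (fun D ↦ ∃ 𝒟 : VacuumCauchyDevelopment D, 𝒟.IsMaximal ∧
          (Summit.FinalStateConjecture.HasCompleteNullInfinity 𝒟.toCauchyDevelopment ∧
            ∃ (N : ℕ) (M a : Fin N → ℝ) (T δ V C₁ C₂ ρ₀ κ : ℝ) (ξ : Fin N → ℝ → EuclideanSpace ℝ (Fin 3))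
              (β : ℝ → ℝ) (U₀ : TopologicalSpace.Opens E4) (B₀ : ModelBackground)
              (B : Fin N → ModelBackground) (Ψ₀ : B₀.domain → 𝒟.carrier)
              (Ψ : (i : Fin N) → (B i).domain → 𝒟.carrier) (O : Set 𝒟.carrier),
              𝒟.toCauchyDevelopment.IsFinalEra₂ N M a T δ V C₁ C₂ ρ₀ κ ξ β U₀ B₀ B Ψ₀ Ψ O ∧
                Summit.FinalStateConjecture.RaysStayInClosure 𝒟.toCauchyDevelopment O ∧
                  (∀ i (ρ : ℝ), ∀ᶠ τ in atTop, ∀ x ∈ (B i).truncTimeSlab ρ τ,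
                    𝒟.toSpacetime.timeOrientation.IsFutureDirected
                      (mfderiv 𝓘(ℝ, E4) (𝓡 4) (Ψ i) x (Kerr.timeVector (M i) (a i) x.1))) ∧
                    ∃ ϱ₀ : ℝ, ∀ᶠ τ in atTop, ∀ x ∈ B₀.timeSlab τ,
                      (∀ i, ϱ₀ ≤ ‖E4.spatial x.1 - ξ i τ‖) →
                        𝒟.toSpacetime.timeOrientation.IsFutureDirected
                          (mfderiv 𝓘(ℝ, E4) (𝓡 4) Ψ₀ x (E4.basisVector 0)))) :=
    funext fun D ↦ propext (finalEraProperty_iff_exists D)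
  rw [hP]

end Summit.FinalStateConjecture.FinalStateConjecture.Theorems.DissipativeFinalMotions.FinalEraGeneric

end
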